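import Summits.MatrixMultiplication.MatrixMultiplication.Theorems.SoloBlindHypergraph

/-!
# The hypergraph Kraft conjecture for at most two vertices; Conjecture E for targets with ≤ 2 representations

Sub-programme (K₃), H-good half.  `SoloBlindHypergraph` reduced Conjecture E to the HYPERGRAPH KRAFT CONJECTURE
(`soloBlindHgKraftConj`): an admissible hypergraph with edges inside its finite vertex set `F` has
`∑_{v ∈ F} 2^{-deg v} ≤ 1/2`.  Here the conjecture is PROVED for `|F| ≤ 2` (`soloBlind_hgKraft_le_of_card_le_two`):
the functional `𝟙_v` (total `1`) forces an edge through every vertex, and for `F = {u, w}` the functional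
`𝟙_u + 2·𝟙_w` (total `0`) together with separation forces edges through `u` alone and through `w` alone, while
`2·𝟙_u + 2·𝟙_w` (total `1`) forces an edge through both — so both degrees are `≥ 2` and the Kraft sum is
`≤ 1/4 + 1/4`.  CONSEQUENCE (`soloBlind_conjE_of_card_repAll_le_two`, unconditional, every rank): Conjecture E
holds at every H-good target with at most two representations.  [Outside the kernel the conjecture is verified
for `|F| ≤ 5` by enumeration.]
-/

namespace Summit.MatrixMultiplication.MatrixMultiplication.Theorems

open Finset

universe u v

section Hypergraph

variable {W : Type*} [DecidableEq W]

/-- Every vertex of an admissible hypergraph lies on an edge (test functional `𝟙_v`). -/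
theorem soloBlind_hgDeg_pos {F : Finset W} {P : Finset (Finset W)} (hadm : soloBlindHgAdmissible F P)
    {v : W} (hv : v ∈ F) : 1 ≤ soloBlindHgDeg P v := by
  obtain ⟨_, h1, _⟩ := hadm
  have hsum : ∑ x ∈ F, (fun x => if x = v then (1 : ZMod 3) else 0) x = 1 := by
    rw [Finset.sum_ite_eq' F v]; simp [hv]
  obtain ⟨J, hJ, hJ1⟩ := h1 _ hsum
  have hvJ : v ∈ J := by
    by_contra hvJ
    unfold soloBlindHgVal at hJ1
    rw [Finset.sum_ite_eq' J v] at hJ1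
    simp [hvJ] at hJ1
  unfold soloBlindHgDeg
  exact Finset.card_pos.mpr ⟨J, Finset.mem_filter.mpr ⟨hJ, hvJ⟩⟩

/-- The value of the two-point functional `a·𝟙_u + b·𝟙_w` on an edge. -/
theorem soloBlind_hgVal_two {u w : W} (huw : u ≠ w) (a b : ZMod 3) (J : Finset W) :
    soloBlindHgVal (fun x => if x = u then a else if x = w then b else 0) J =
      (if u ∈ J then a else 0) + (if w ∈ J then b else 0) := by
  unfold soloBlindHgVal
  have hsplit : ∀ x ∈ J, (if x = u then a else if x = w then b else 0) =
      (if x = u then a else 0) + (if x = w then b else 0) := by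
    intro x _
    by_cases hxu : x = u
    · subst hxu; simp [huw]
    · simp [hxu]
  rw [Finset.sum_congr rfl hsplit, Finset.sum_add_distrib, Finset.sum_ite_eq' J u, Finset.sum_ite_eq' J w]

/-- The total of the two-point functional on `F = {u, w}`. -/
theorem soloBlind_sum_two {u w : W} (huw : u ≠ w) (a b : ZMod 3) :
    ∑ x ∈ ({u, w} : Finset W), (fun x => if x = u then a else if x = w then b else 0) x = a + b := by
  rw [Finset.sum_pair huw]
  simp [huw.symm]

/-- THE HYPERGRAPH KRAFT CONJECTURE FOR AT MOST TWO VERTICES. -/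
theorem soloBlind_hgKraft_le_of_card_le_two (F : Finset W) (P : Finset (Finset W))
    (hPF : ∀ J ∈ P, J ⊆ F) (hadm : soloBlindHgAdmissible F P) (hcard : F.card ≤ 2) :
    soloBlindHgKraft F P ≤ 1 / 2 := by
  have hhalf : ∀ v ∈ F, (1 / 2 : ℚ) ^ soloBlindHgDeg P v ≤ 1 / 2 := fun v hv =>
    pow_le_of_le_one (by norm_num) (by norm_num) (by have := soloBlind_hgDeg_pos hadm hv; omega)
  by_cases hc2 : F.card = 2
  · -- two vertices `u ≠ w`
    obtain ⟨u, w, huw, rfl⟩ := Finset.card_eq_two.mp hc2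
    obtain ⟨hsep, h1, h0⟩ := hadm
    have hu : u ∈ ({u, w} : Finset W) := by simp
    have hw : w ∈ ({u, w} : Finset W) := by simp
    -- an edge through both: functional `2·𝟙_u + 2·𝟙_w` (total `4 = 1`)
    obtain ⟨J₂, hJ₂, hJ₂v⟩ := h1 _ (by rw [soloBlind_sum_two huw 2 2]; decide)
    rw [soloBlind_hgVal_two huw] at hJ₂v
    have hJ₂uw : u ∈ J₂ ∧ w ∈ J₂ := by
      by_cases hu2 : u ∈ J₂ <;> by_cases hw2 : w ∈ J₂ <;> simp [hu2, hw2] at hJ₂v ⊢ <;> revert hJ₂v <;> decide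
    -- edges through `u` alone and through `w` alone: functional `𝟙_u + 2·𝟙_w` (total `0`) + separation
    have hiff := h0 _ (by rw [soloBlind_sum_two huw 1 2]; decide)
    simp_rw [soloBlind_hgVal_two huw] at hiff
    have val1 : ∀ J : Finset W, ((if u ∈ J then (1 : ZMod 3) else 0) + (if w ∈ J then 2 else 0) = 1) ↔
        (u ∈ J ∧ w ∉ J) := by
      intro J; by_cases huJ : u ∈ J <;> by_cases hwJ : w ∈ J <;> simp [huJ, hwJ] <;> decide
    have val2 : ∀ J : Finset W, ((if u ∈ J then (1 : ZMod 3) else 0) + (if w ∈ J then 2 else 0) = 2) ↔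
        (w ∈ J ∧ u ∉ J) := by
      intro J; by_cases huJ : u ∈ J <;> by_cases hwJ : w ∈ J <;> simp [huJ, hwJ] <;> decide
    simp_rw [val1, val2] at hiff
    obtain ⟨J₀, hJ₀, hJ₀sep⟩ := hsep u hu w hw huw
    have hboth : (∃ J ∈ P, u ∈ J ∧ w ∉ J) ∧ (∃ J ∈ P, w ∈ J ∧ u ∉ J) := by
      by_cases huJ : u ∈ J₀
      · have hwJ : w ∉ J₀ := fun hwJ => hJ₀sep ⟨fun _ => hwJ, fun _ => huJ⟩
        exact ⟨⟨J₀, hJ₀, huJ, hwJ⟩, hiff.mp ⟨J₀, hJ₀, huJ, hwJ⟩⟩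
      · have hwJ : w ∈ J₀ := by
          by_contra hwJ; exact hJ₀sep ⟨fun h => absurd h huJ, fun h => absurd h hwJ⟩
        exact ⟨hiff.mpr ⟨J₀, hJ₀, hwJ, huJ⟩, ⟨J₀, hJ₀, hwJ, huJ⟩⟩
    obtain ⟨⟨Ju, hJu, huJu, hwJu⟩, ⟨Jw, hJw, hwJw, huJw⟩⟩ := hboth
    -- degrees ≥ 2
    have hdu : 2 ≤ soloBlindHgDeg P u := by
      unfold soloBlindHgDeg
      have hne : Ju ≠ J₂ := fun h => hwJu (h ▸ hJ₂uw.2)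
      calc 2 = ({Ju, J₂} : Finset (Finset W)).card := (Finset.card_pair hne).symm
        _ ≤ _ := Finset.card_le_card (fun J hJ => by
            rcases Finset.mem_insert.mp hJ with rfl | hJ
            · exact Finset.mem_filter.mpr ⟨hJu, huJu⟩
            · rw [Finset.mem_singleton.mp hJ]; exact Finset.mem_filter.mpr ⟨hJ₂, hJ₂uw.1⟩)
    have hdw : 2 ≤ soloBlindHgDeg P w := by
      unfold soloBlindHgDeg
      have hne : Jw ≠ J₂ := fun h => huJw (h ▸ hJ₂uw.1)
      calc 2 = ({Jw, J₂} : Finset (Finset W)).card := (Finset.card_pair hne).symm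
        _ ≤ _ := Finset.card_le_card (fun J hJ => by
            rcases Finset.mem_insert.mp hJ with rfl | hJ
            · exact Finset.mem_filter.mpr ⟨hJw, hwJw⟩
            · rw [Finset.mem_singleton.mp hJ]; exact Finset.mem_filter.mpr ⟨hJ₂, hJ₂uw.2⟩)
    unfold soloBlindHgKraft
    rw [Finset.sum_pair huw]
    have hqu : (1 / 2 : ℚ) ^ soloBlindHgDeg P u ≤ (1 / 2) ^ 2 :=
      pow_le_pow_of_le_one (by norm_num) (by norm_num) hdu
    have hqw : (1 / 2 : ℚ) ^ soloBlindHgDeg P w ≤ (1 / 2) ^ 2 :=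
      pow_le_pow_of_le_one (by norm_num) (by norm_num) hdw
    linarith
  · -- at most one vertex
    have hc1 : F.card ≤ 1 := by omega
    unfold soloBlindHgKraft
    calc ∑ v ∈ F, (1 / 2 : ℚ) ^ soloBlindHgDeg P v ≤ ∑ v ∈ F, (1 / 2 : ℚ) := Finset.sum_le_sum hhalf
      _ = F.card • (1 / 2 : ℚ) := Finset.sum_const _
      _ ≤ 1 / 2 := by
          rw [nsmul_eq_mul]
          have : (F.card : ℚ) ≤ 1 := by exact_mod_cast hc1
          linarith

end Hypergraph

variable {ι : Type v} [DecidableEq ι]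
variable {G : Type u} [AddCommGroup G] [DecidableEq G]

/-- CONJECTURE E AT TARGETS WITH AT MOST TWO REPRESENTATIONS (unconditional, every rank): if `σ` is H-good for the
zero-sum-free `h` on `S` in a group of exponent `3` and has at most two representations, then
`soloBlindMass h S σ ≤ 1/2`. -/
theorem soloBlind_conjE_of_card_repAll_le_two (three : ∀ g : G, g + g + g = 0) (h : ι → G) (S : Finset ι)
    (σ : G) (zsf : ∀ T ⊆ S, T.Nonempty → ∑ i ∈ T, h i ≠ 0) (hgood : ∀ T ⊆ S, ∑ i ∈ T, h i ≠ σ + σ)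
    (hN : (soloBlindSeqRepAll h S σ).card ≤ 2) : soloBlindMass h S σ ≤ 1 / 2 :=
  (soloBlind_mass_le_hgKraft h S σ).trans
    (soloBlind_hgKraft_le_of_card_le_two _ _ (soloBlind_atomHg_edge_subset h S σ)
      (soloBlind_atomHg_admissible three zsf hgood) hN)

end Summit.MatrixMultiplication.MatrixMultiplication.Theorems
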